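import Summits.AtomisticToContinuum.FouriersLaw.Theorems.BondHeatUncertaintySubdiffusiveBondHeatSiteEnergyDynkinTruncation

/-!
# `PhononMeanFreePath.IncoherentBounded` — Dynkin's identity by truncation for energy-dominated observables

Helper file for item `stmt-AtomisticToContinuum-11815` (support `IncoherentBounded`, route `PhononMeanFreePath`,
sub-problem `FouriersLaw`). The template behind `stub_siteEnergyDynkin`, `pinnedChain_hamiltonian_dynkin` and the
left-block-energy identity of `…IncoherentBoundedLeftEnergyDynkin`, made reusable: for the pinned anharmonic chain
`pinnedChain ω₂ lam β γ` (`ω₂, β, γ > 0`, `lam ≥ 0`), `N ≥ 1` sites, equal bath temperatures `T > 0`, the CONSTRUCTED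
kernels `P_t = transitionKernel N T T t`, and a `C²` observable `e` with `0 ≤ e ≤ H`, `|∂_{p_b} e| ≤ |p_b|` at the two bath
sites and `|Le| ≤ B (1 + H)²`:

* `pinnedChain_abs_generator_trunc_sub_le_of_bounds` — the truncation error `|L(e χ(H/R)) - χ(H/R) Le| ≤ (A/R)(1+H)²`
  (`generator_mul_smoothCutoff_hamiltonian`: the difference is `e Lχ_R + Γ(e, χ_R)`);
* `pinnedChain_dynkin_of_growth` — **`P_r e(z) - e(z) = ∫₀ʳ P_s(Le)(z) ds`** for all `r ≥ 0`, `z`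
  (`pinnedChain_dynkin_of_truncation`, dominated convergence through CEHR (3.4) with the weight `e^{H/(2T)}`).

No definitions; nothing here closes an item.
-/

noncomputable section

open MeasureTheory ProbabilityTheory Filter Topology Set
open scoped NNReal ENNReal
open Literature.MathematicalPhysics.KineticTheory.HeatConduction
open Literature.MathematicalPhysics.KineticTheory Literature.Probability.Process OscillatorChain
open Summit.AtomisticToContinuum.FouriersLaw.Theorems.SubdiffusiveBondHeat

namespace Summit.AtomisticToContinuum.FouriersLaw.Theorems.IncoherentBounded

/-! ## 1. Dynkin by truncation for observables dominated by the energy -/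

section General

variable {ω₂ lam β γ : ℝ}

/-- **Truncation error for an energy-dominated observable.** For the pinned chain (`ω₂, lam, β, γ ≥ 0`, `N ≥ 1`,
equal bath temperatures `T ≥ 0`) and `e ∈ C²` with `0 ≤ e ≤ H` and `|∂_{p_b} e| ≤ |p_b|` at both bath sites, there is
`A ≥ 0` with `|L(e χ(H/R)) - χ(H/R) Le| ≤ (A/R)(1 + H)²` for all `R ≥ 1` (`generator_mul_smoothCutoff_hamiltonian`:
the difference is `e Lχ_R + Γ(e, χ_R)`; `|χ'|, |χ''|` bounded, `p_b² ≤ 2H`). [folklore] -/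
theorem pinnedChain_abs_generator_trunc_sub_le_of_bounds (hω : 0 ≤ ω₂) (hl : 0 ≤ lam) (hβ : 0 ≤ β) (hγ : 0 ≤ γ)
    {N : ℕ} (hN : 0 < N) {T : ℝ} (hT : 0 ≤ T) {e : PhaseSpace N → ℝ} (he : ContDiff ℝ 2 e)
    (he0 : ∀ x, 0 ≤ e x) (heH : ∀ x, e x ≤ (pinnedChain ω₂ lam β γ).hamiltonian N x)
    (hd0 : ∀ x, |partialP ⟨0, hN⟩ e x| ≤ |x.2 ⟨0, hN⟩|)
    (hdN : ∀ x, |partialP ⟨N - 1, Nat.sub_lt hN one_pos⟩ e x| ≤ |x.2 ⟨N - 1, Nat.sub_lt hN one_pos⟩|) :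
    ∃ A : ℝ, 0 ≤ A ∧ ∀ R : ℝ, 1 ≤ R → ∀ x : PhaseSpace N,
      |(pinnedChain ω₂ lam β γ).generator N T T (fun y =>
            e y * smoothCutoff ((pinnedChain ω₂ lam β γ).hamiltonian N y / R)) x -
          smoothCutoff ((pinnedChain ω₂ lam β γ).hamiltonian N x / R) *
            (pinnedChain ω₂ lam β γ).generator N T T e x| ≤
        A / R * (1 + (pinnedChain ω₂ lam β γ).hamiltonian N x) ^ 2 := by
  obtain ⟨M₁, hM₁0, hM₁⟩ := exists_bound_deriv_smoothCutoff
  obtain ⟨M₂, hM₂0, hM₂⟩ := exists_bound_deriv_deriv_smoothCutoff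
  refine ⟨γ * (10 * M₁ * T + 4 * M₁ + 4 * M₂ * T), by positivity, fun R hR x => ?_⟩
  have hR0 : 0 < R := lt_of_lt_of_le one_pos hR
  set P := pinnedChain ω₂ lam β γ with hP
  have hTγ : 0 ≤ P.γ * T := mul_nonneg hγ hT
  have hU2 : ContDiff ℝ 2 P.U := pinnedChain_contDiff_U ω₂ lam β γ
  have hV2 : ContDiff ℝ 2 P.V := pinnedChain_contDiff_V ω₂ lam β γ
  have hγ' : P.γ = γ := rfl
  rw [generator_mul_smoothCutoff_hamiltonian hU2 hV2 hN hTγ hTγ he R x, hγ', add_sub_cancel_left]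
  -- the elementary bounds
  have hH0 : 0 ≤ P.hamiltonian N x := pinnedChain_hamiltonian_nonneg hω hl hβ γ N x
  have hU0 : ∀ q, 0 ≤ P.U q := fun q => by
    show 0 ≤ ω₂ * q ^ 2 / 2 + lam * q ^ 4 / 4; positivity
  have hV0 : ∀ r, 0 ≤ P.V r := fun r => by
    show 0 ≤ r ^ 2 / 2 + β * r ^ 4 / 4; positivity
  have haH : x.2 ⟨0, hN⟩ ^ 2 ≤ 2 * P.hamiltonian N x := by
    have h1 := P.site_le_hamiltonian hU0 hV0 N x ⟨0, hN⟩
    have h2 := hU0 (x.1 ⟨0, hN⟩)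
    linarith
  have hbH : x.2 ⟨N - 1, Nat.sub_lt hN one_pos⟩ ^ 2 ≤ 2 * P.hamiltonian N x := by
    have h1 := P.site_le_hamiltonian hU0 hV0 N x ⟨N - 1, Nat.sub_lt hN one_pos⟩
    have h2 := hU0 (x.1 ⟨N - 1, Nat.sub_lt hN one_pos⟩)
    linarith
  have hχ₁b := hM₁ (P.hamiltonian N x / R)
  have hχ₂b := hM₂ (P.hamiltonian N x / R)
  have hex := he0 x
  have heHx := heH x
  have hda := hd0 x
  have hdb := hdN x
  -- make the atoms opaque
  generalize deriv smoothCutoff (P.hamiltonian N x / R) = χ₁ at hχ₁b ⊢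
  generalize deriv (deriv smoothCutoff) (P.hamiltonian N x / R) = χ₂ at hχ₂b ⊢
  generalize partialP ⟨0, hN⟩ e x = da at hda ⊢
  generalize partialP ⟨N - 1, Nat.sub_lt hN one_pos⟩ e x = db at hdb ⊢
  generalize e x = E at hex heHx ⊢
  generalize P.hamiltonian N x = Hx at hH0 haH hbH heHx ⊢
  generalize x.2 ⟨0, hN⟩ = p at haH hda ⊢
  generalize x.2 ⟨N - 1, Nat.sub_lt hN one_pos⟩ = q at hbH hdb ⊢
  have ha0 : 0 ≤ p ^ 2 := sq_nonneg _
  have hb0 : 0 ≤ q ^ 2 := sq_nonneg _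
  have hpa : |p * da| ≤ p ^ 2 := by
    rw [abs_mul, sq, ← abs_mul_abs_self p]
    exact mul_le_mul_of_nonneg_left hda (abs_nonneg _)
  have hpb : |q * db| ≤ q ^ 2 := by
    rw [abs_mul, sq, ← abs_mul_abs_self q]
    exact mul_le_mul_of_nonneg_left hdb (abs_nonneg _)
  have key : E * (γ * (χ₁ / R * (T + T - p ^ 2 - q ^ 2) + χ₂ / R ^ 2 * (T * p ^ 2 + T * q ^ 2))) +
      χ₁ / R * (2 * γ * T * p * da + 2 * γ * T * q * db) =
      γ / R * (E * (χ₁ * (2 * T - p ^ 2 - q ^ 2) + χ₂ * T * (p ^ 2 + q ^ 2) / R) +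
        χ₁ * (2 * T * (p * da + q * db))) := by
    field_simp; ring
  have hin : |E * (χ₁ * (2 * T - p ^ 2 - q ^ 2) + χ₂ * T * (p ^ 2 + q ^ 2) / R) + χ₁ * (2 * T * (p * da + q * db))| ≤
      E * (M₁ * (2 * T + p ^ 2 + q ^ 2) + M₂ * T * (p ^ 2 + q ^ 2)) + M₁ * (2 * T * (p ^ 2 + q ^ 2)) := by
    have h1 : |χ₁ * (2 * T - p ^ 2 - q ^ 2)| ≤ M₁ * (2 * T + p ^ 2 + q ^ 2) := by
      rw [abs_mul]
      refine mul_le_mul hχ₁b ?_ (abs_nonneg _) hM₁0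
      rw [abs_le]; constructor <;> linarith
    have h2 : |χ₂ * T * (p ^ 2 + q ^ 2) / R| ≤ M₂ * T * (p ^ 2 + q ^ 2) := by
      rw [abs_div, abs_mul, abs_mul, abs_of_nonneg hT, abs_of_nonneg (add_nonneg ha0 hb0), abs_of_pos hR0]
      calc |χ₂| * T * (p ^ 2 + q ^ 2) / R ≤ |χ₂| * T * (p ^ 2 + q ^ 2) / 1 :=
            div_le_div_of_nonneg_left (by positivity) one_pos hR
        _ ≤ M₂ * T * (p ^ 2 + q ^ 2) := by
            rw [div_one]
            exact mul_le_mul_of_nonneg_right (mul_le_mul_of_nonneg_right hχ₂b hT) (add_nonneg ha0 hb0)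
    have h3 : |χ₁ * (2 * T * (p * da + q * db))| ≤ M₁ * (2 * T * (p ^ 2 + q ^ 2)) := by
      rw [abs_mul]
      refine mul_le_mul hχ₁b ?_ (abs_nonneg _) hM₁0
      rw [abs_mul, abs_of_nonneg (by positivity : (0:ℝ) ≤ 2 * T)]
      exact mul_le_mul_of_nonneg_left ((abs_add_le _ _).trans (add_le_add hpa hpb)) (by positivity)
    calc |E * (χ₁ * (2 * T - p ^ 2 - q ^ 2) + χ₂ * T * (p ^ 2 + q ^ 2) / R) + χ₁ * (2 * T * (p * da + q * db))|
        ≤ |E * (χ₁ * (2 * T - p ^ 2 - q ^ 2) + χ₂ * T * (p ^ 2 + q ^ 2) / R)| + |χ₁ * (2 * T * (p * da + q * db))| :=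
          abs_add_le _ _
      _ = E * |χ₁ * (2 * T - p ^ 2 - q ^ 2) + χ₂ * T * (p ^ 2 + q ^ 2) / R| + |χ₁ * (2 * T * (p * da + q * db))| := by
          rw [abs_mul, abs_of_nonneg hex]
      _ ≤ E * (|χ₁ * (2 * T - p ^ 2 - q ^ 2)| + |χ₂ * T * (p ^ 2 + q ^ 2) / R|) + |χ₁ * (2 * T * (p * da + q * db))| := by
          gcongr
          exact abs_add_le _ _
      _ ≤ E * (M₁ * (2 * T + p ^ 2 + q ^ 2) + M₂ * T * (p ^ 2 + q ^ 2)) + M₁ * (2 * T * (p ^ 2 + q ^ 2)) := by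
          gcongr
  have hpoly : E * (M₁ * (2 * T + p ^ 2 + q ^ 2) + M₂ * T * (p ^ 2 + q ^ 2)) + M₁ * (2 * T * (p ^ 2 + q ^ 2)) ≤
      (10 * M₁ * T + 4 * M₁ + 4 * M₂ * T) * (1 + Hx) ^ 2 := by
    have s1 : E * (M₁ * (2 * T + p ^ 2 + q ^ 2) + M₂ * T * (p ^ 2 + q ^ 2)) ≤
        Hx * (M₁ * (2 * T + 4 * Hx) + M₂ * T * (4 * Hx)) := by
      refine mul_le_mul heHx ?_ (by positivity) hH0
      have := mul_nonneg hM₂0 hT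
      nlinarith
    have s2 : M₁ * (2 * T * (p ^ 2 + q ^ 2)) ≤ M₁ * (2 * T * (4 * Hx)) :=
      mul_le_mul_of_nonneg_left (mul_le_mul_of_nonneg_left (by linarith) (by positivity)) hM₁0
    nlinarith [mul_nonneg hM₁0 hT, mul_nonneg (mul_nonneg hM₁0 hT) hH0, mul_nonneg hM₁0 hH0,
      mul_nonneg (mul_nonneg hM₁0 hT) (sq_nonneg Hx), mul_nonneg hM₂0 hT,
      mul_nonneg (mul_nonneg hM₂0 hT) hH0, mul_nonneg hM₁0 (sq_nonneg Hx)]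
  rw [key, abs_mul, abs_div, abs_of_nonneg hγ, abs_of_pos hR0]
  calc γ / R * |E * (χ₁ * (2 * T - p ^ 2 - q ^ 2) + χ₂ * T * (p ^ 2 + q ^ 2) / R) + χ₁ * (2 * T * (p * da + q * db))|
      ≤ γ / R * (E * (M₁ * (2 * T + p ^ 2 + q ^ 2) + M₂ * T * (p ^ 2 + q ^ 2)) + M₁ * (2 * T * (p ^ 2 + q ^ 2))) :=
        mul_le_mul_of_nonneg_left hin (div_nonneg hγ hR0.le)
    _ ≤ γ / R * ((10 * M₁ * T + 4 * M₁ + 4 * M₂ * T) * (1 + Hx) ^ 2) :=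
        mul_le_mul_of_nonneg_left hpoly (div_nonneg hγ hR0.le)
    _ = γ * (10 * M₁ * T + 4 * M₁ + 4 * M₂ * T) / R * (1 + Hx) ^ 2 := by ring

/-- **Dynkin's identity for an energy-dominated observable of the pinned anharmonic chain.** For
`pinnedChain ω₂ lam β γ` (`ω₂, β, γ > 0`, `lam ≥ 0`), `N ≥ 1`, equal bath temperatures `T > 0`, the constructed kernels
`P_t`, and `e ∈ C²` with `0 ≤ e ≤ H`, `|∂_{p_b} e| ≤ |p_b|` at both bath sites, `Le = ℓ` continuous with
`|ℓ| ≤ B(1+H)²`: `P_r e(z) - e(z) = ∫₀ʳ P_s ℓ(z) ds` for all `r ≥ 0`, `z` (truncations `e χ(H/R)`,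
`pinnedChain_dynkin_of_truncation`, weight `e^{H/(2T)}`). [cite: CuneoEckmannHairerReyBellet2018, §3 eq. (3.2)–(3.4)] -/
theorem pinnedChain_dynkin_of_growth (hω : 0 < ω₂) (hl : 0 ≤ lam) (hβ : 0 < β) (hγ : 0 < γ) {N : ℕ} (hN : 0 < N)
    {T : ℝ} (hT : 0 < T) {e ℓ : PhaseSpace N → ℝ} (he : ContDiff ℝ 2 e)
    (he0 : ∀ x, 0 ≤ e x) (heH : ∀ x, e x ≤ (pinnedChain ω₂ lam β γ).hamiltonian N x)
    (hd0 : ∀ x, |partialP ⟨0, hN⟩ e x| ≤ |x.2 ⟨0, hN⟩|)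
    (hdN : ∀ x, |partialP ⟨N - 1, Nat.sub_lt hN one_pos⟩ e x| ≤ |x.2 ⟨N - 1, Nat.sub_lt hN one_pos⟩|)
    (hgen : ∀ x, (pinnedChain ω₂ lam β γ).generator N T T e x = ℓ x)
    {B : ℝ} (hB : 0 ≤ B) (hℓb : ∀ y, |ℓ y| ≤ B * (1 + (pinnedChain ω₂ lam β γ).hamiltonian N y) ^ 2)
    (r : ℝ≥0) (z : PhaseSpace N) :
    ∫ y, e y ∂((pinnedChain ω₂ lam β γ).transitionKernel N T T r z) - e z =
      ∫ s in (0 : ℝ)..(r : ℝ), ∫ y, ℓ y ∂((pinnedChain ω₂ lam β γ).transitionKernel N T T s.toNNReal z) := by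
  obtain ⟨A, hA0, hA⟩ := pinnedChain_abs_generator_trunc_sub_le_of_bounds (γ := γ) hω.le hl hβ.le hγ.le hN hT.le
    he he0 heH hd0 hdN
  set θ : ℝ := 1 / (2 * T) with hθ
  have hθ0 : 0 < θ := by positivity
  have hθ1 : θ < 1 / T := by
    rw [hθ, div_lt_div_iff₀ (by positivity) hT]; nlinarith
  set C₀ : ℝ := 2 * Real.exp θ / θ ^ 2 with hC₀
  have hC₀0 : 0 ≤ C₀ := by positivity
  set H : PhaseSpace N → ℝ := (pinnedChain ω₂ lam β γ).hamiltonian N with hH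
  set f : ℕ → PhaseSpace N → ℝ := fun n y => e y * smoothCutoff (H y / (n + 1)) with hf
  have hfdef : ∀ n y, f n y = e y * smoothCutoff (H y / (n + 1)) := fun n y => rfl
  have hU2 : ContDiff ℝ 2 (pinnedChain ω₂ lam β γ).U := pinnedChain_contDiff_U ω₂ lam β γ
  have hV2 : ContDiff ℝ 2 (pinnedChain ω₂ lam β γ).V := pinnedChain_contDiff_V ω₂ lam β γ
  have hH2 : ContDiff ℝ 2 H := (pinnedChain ω₂ lam β γ).contDiff_hamiltonian hU2 hV2 N
  have hH0 : ∀ y, 0 ≤ H y := fun y => pinnedChain_hamiltonian_nonneg hω.le hl hβ.le γ N y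
  have hRpos : ∀ n : ℕ, (0:ℝ) < n + 1 := fun n => by positivity
  have hR1 : ∀ n : ℕ, (1:ℝ) ≤ n + 1 := fun n => by
    have : (0:ℝ) ≤ n := Nat.cast_nonneg n
    linarith
  have hf2 : ∀ n, ContDiff ℝ 2 (f n) := fun n =>
    he.mul ((contDiff_smoothCutoff (n := 2)).comp (hH2.div_const _))
  have hfs : ∀ n, HasCompactSupport (f n) := fun n => by
    refine HasCompactSupport.intro
      (pinnedChain_isCompact_setOf_hamiltonian_le hω hl hβ.le γ N (2 * (n + 1))) fun y hy => ?_
    simp only [mem_setOf_eq, not_le] at hy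
    have h2 : 2 ≤ H y / (n + 1) := by
      rw [le_div_iff₀ (hRpos n)]; rw [hH]; linarith
    rw [hfdef, smoothCutoff_of_two_le h2, mul_zero]
  have hev : ∀ y, ∀ᶠ n : ℕ in atTop, smoothCutoff (H y / (n + 1)) = 1 := by
    intro y
    obtain ⟨n₀, hn₀⟩ := exists_nat_ge (H y)
    filter_upwards [eventually_ge_atTop n₀] with n hn
    have h1 : H y / (n + 1) ≤ 1 := by
      rw [div_le_one (hRpos n)]
      have : (n₀ : ℝ) ≤ n := by exact_mod_cast hn
      linarith
    exact smoothCutoff_of_le_one h1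
  have hsq : ∀ y, (1 + H y) ^ 2 ≤ C₀ * Real.exp (θ * H y) := fun y => one_add_sq_le_exp (hH0 y) hθ0
  have herr : ∀ (n : ℕ) (y : PhaseSpace N),
      |(pinnedChain ω₂ lam β γ).generator N T T (f n) y - smoothCutoff (H y / (n + 1)) * ℓ y| ≤
        A / (n + 1) * (1 + H y) ^ 2 := fun n y => by
    have h := hA (n + 1) (hR1 n) y
    rw [hgen y] at h
    exact h
  have hfb : ∀ (n : ℕ) (y : PhaseSpace N), |f n y| ≤ (A + B + 1) * C₀ * Real.exp (θ * H y) := by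
    intro n y
    have h0 := he0 y
    have h1 : e y ≤ H y := heH y
    have hχ0 := smoothCutoff_nonneg (H y / (n + 1))
    have hχ1 := smoothCutoff_le_one (H y / (n + 1))
    have hs := hsq y
    have hHy := hH0 y
    rw [hfdef, abs_of_nonneg (mul_nonneg h0 hχ0)]
    generalize H y = Hy at h1 hs hHy hχ0 hχ1 ⊢
    generalize smoothCutoff (Hy / (n + 1)) = c at hχ0 hχ1 ⊢
    generalize e y = E at h0 h1 ⊢
    calc E * c ≤ E := mul_le_of_le_one_right h0 hχ1
      _ ≤ 1 * (1 + Hy) ^ 2 := by nlinarith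
      _ ≤ (A + B + 1) * (1 + Hy) ^ 2 := by gcongr; linarith
      _ ≤ (A + B + 1) * (C₀ * Real.exp (θ * Hy)) := by gcongr
      _ = (A + B + 1) * C₀ * Real.exp (θ * Hy) := by ring
  have hLb : ∀ (n : ℕ) (y : PhaseSpace N), |(pinnedChain ω₂ lam β γ).generator N T T (f n) y| ≤
      (A + B + 1) * C₀ * Real.exp (θ * H y) := by
    intro n y
    have h1 := herr n y
    have h2 := hℓb y
    have hs := hsq y
    have hHy := hH0 y
    have hχ0 := smoothCutoff_nonneg (H y / (n + 1))
    have hχ1 := smoothCutoff_le_one (H y / (n + 1))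
    generalize (pinnedChain ω₂ lam β γ).generator N T T (f n) y = G at h1 ⊢
    change |ℓ y| ≤ B * (1 + H y) ^ 2 at h2
    generalize H y = Hy at h1 h2 hs hHy hχ0 hχ1 ⊢
    generalize smoothCutoff (Hy / (n + 1)) = c at hχ0 hχ1 h1 ⊢
    generalize ℓ y = l at h1 h2 ⊢
    have h3 : |c * l| ≤ B * (1 + Hy) ^ 2 := by
      rw [abs_mul, abs_of_nonneg hχ0]
      calc c * |l| ≤ 1 * |l| := mul_le_mul_of_nonneg_right hχ1 (abs_nonneg _)
        _ ≤ B * (1 + Hy) ^ 2 := by rw [one_mul]; exact h2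
    have h4 : A / (n + 1) * (1 + Hy) ^ 2 ≤ A * (1 + Hy) ^ 2 :=
      mul_le_mul_of_nonneg_right (div_le_self hA0 (hR1 n)) (sq_nonneg _)
    calc |G| ≤ |G - c * l| + |c * l| := by
          have := abs_add_le (G - c * l) (c * l); rwa [sub_add_cancel] at this
      _ ≤ A * (1 + Hy) ^ 2 + B * (1 + Hy) ^ 2 := add_le_add (h1.trans h4) h3
      _ ≤ (A + B + 1) * (1 + Hy) ^ 2 := by nlinarith [sq_nonneg (1 + Hy)]
      _ ≤ (A + B + 1) * (C₀ * Real.exp (θ * Hy)) := by gcongr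
      _ = (A + B + 1) * C₀ * Real.exp (θ * Hy) := by ring
  have hfe : ∀ y, Tendsto (fun n => f n y) atTop (𝓝 (e y)) := fun y => by
    refine tendsto_const_nhds.congr' ?_
    filter_upwards [hev y] with n hn
    rw [hfdef, hn, mul_one]
  have hfℓ : ∀ y, Tendsto (fun n => (pinnedChain ω₂ lam β γ).generator N T T (f n) y) atTop (𝓝 (ℓ y)) := by
    intro y
    have hg : Tendsto (fun n : ℕ => smoothCutoff (H y / (n + 1)) * ℓ y) atTop (𝓝 (ℓ y)) := by
      refine tendsto_const_nhds.congr' ?_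
      filter_upwards [hev y] with n hn
      rw [hn, one_mul]
    have hd : Tendsto (fun n : ℕ => (pinnedChain ω₂ lam β γ).generator N T T (f n) y -
        smoothCutoff (H y / (n + 1)) * ℓ y) atTop (𝓝 0) := by
      have hCn : Tendsto (fun n : ℕ => A / (n + 1) * (1 + H y) ^ 2) atTop (𝓝 0) := by
        have h1 : Tendsto (fun n : ℕ => A / ((n : ℝ) + 1)) atTop (𝓝 0) :=
          tendsto_const_nhds.div_atTop (tendsto_natCast_atTop_atTop.atTop_add tendsto_const_nhds)
        simpa using h1.mul_const ((1 + H y) ^ 2)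
      exact squeeze_zero_norm (fun n => by rw [Real.norm_eq_abs]; exact herr n y) hCn
    have := hd.add hg
    simpa using this
  exact pinnedChain_dynkin_of_truncation hω hl hβ hγ hN hT hθ0 hθ1 f hf2 hfs hfe hfℓ hfb hLb r z

end General

end Summit.AtomisticToContinuum.FouriersLaw.Theorems.IncoherentBounded

end
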